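import Summits.QuantumAdvantage.QuantumAdvantage.Theses.RingFrame
import Summits.QuantumAdvantage.QuantumAdvantage.Theorems.RingFrameBeta
import Summits.QuantumAdvantage.QuantumAdvantage.Theorems.RingFrameBridge
import Summits.QuantumAdvantage.AdviceFreeQNC0.ProductBound
import Summits.QuantumAdvantage.AdviceFreeQNC0.CrossTeamEmbedding
import Summits.QuantumAdvantage.AdviceFreeQNC0.WalkTransport
import HarnessLib

/-!
# Route RingFrame, crux α `RingToElim` (stmt-QuantumAdvantage-19119): the crux from `LDMAPolylog` alone

Support theorem for the crux item: composing the four stubs of planner qa-qnc0-p1's line `product`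
that are PROVED in the cell topic —

* `stub_product`      : `productHard_of_ldma_of_elimHard` (`ProductBound.lean`),
* `stub_crossToProduct`: `crossTeamHard_of_productHard` (`CrossToProduct.lean`),
* `stub_embed`        : `ringHardU_of_crossTeamHard` (`CrossTeamEmbedding.lean`),
* `stub_transport`    : `ringHard_two_of_walkHard` (`WalkTransport.lean`) —

gives the route crux `Summit.QuantumAdvantage.QuantumAdvantage.Theses.RingFrame.RingToElim`
(`ElimHard → RingHard 2`, `ElimHard` inline) from the single remaining, load-bearing hypothesis of
the line, `LDMAPolylog` (weighted residue non-avoidance for column-low-degree maps; planner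
qa-qnc0-p1 TARGET §17.4; OPEN, not in print), stated here as an explicit hypothesis with its body
verbatim from the registered skeleton. So, in the kernel: `LDMAPolylog ⟹ RingToElim`, and with the
closed items β/bridge of the route, `LDMAPolylog ⟹ AdviceFreeQNC0` (`adviceFreeQNC0_of_ldma`).

WHAT THIS IS NOT: not a proof of the crux — `LDMAPolylog` is open.
-/

-- the sub-problem namespace `Summit.QuantumAdvantage.QuantumAdvantage` repeats the summit name by design (D-0017)
set_option linter.dupNamespace false

namespace Summit.QuantumAdvantage.QuantumAdvantage.Theorems

open Finset Summit.QuantumAdvantage.AdviceFreeQNC0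
open Literature.Computability.MetaComplexity Literature.Computability.MetaComplexity.Smolensky

/-- **Crux α from `LDMAPolylog`**: the body of line `product`'s load-bearing stub implies the route
crux `RingToElim` (all other stubs of the line are theorems of the cell topic). -/
theorem ringToElim_of_ldma
    (hL : ∃ κ : ℝ, 0 < κ ∧ ∀ C : ℕ, ∃ L₀ : ℕ, ∀ L L' : ℕ, L₀ ≤ L → L₀ ≤ L' → ∀ D : ℕ,
      D ≤ (Nat.log 2 (min L L')) ^ C →
        ∀ Γ : (Fin L → Bool) → (Fin L' → Bool) → Bool, (∀ v, HasDeg (fun u => Γ u v) D) → ∀ r : ℕ,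
          κ * ((∑ u : Fin L → Bool, distFail D (Γ u) : ℕ) : ℝ) ≤
            ((∑ u ∈ univ.filter (fun u : Fin L → Bool => wt u % 3 = r % 3), distFail D (Γ u) : ℕ) : ℝ)) :
    Summit.QuantumAdvantage.QuantumAdvantage.Theses.RingFrame.RingToElim :=
  fun hE => ringHard_two_of_walkHard (ringHardU_of_crossTeamHard (crossTeamHard_of_productHard
    (productHard_of_ldma_of_elimHard hL hE)))

/-- **The rung leaf from `LDMAPolylog`**: with the route's closed items (β side, the bridge
`RingHard 2 → AdviceFreeQNC0`) the whole route reduces to `LDMAPolylog`. -/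
theorem adviceFreeQNC0_of_ldma
    (hL : ∃ κ : ℝ, 0 < κ ∧ ∀ C : ℕ, ∃ L₀ : ℕ, ∀ L L' : ℕ, L₀ ≤ L → L₀ ≤ L' → ∀ D : ℕ,
      D ≤ (Nat.log 2 (min L L')) ^ C →
        ∀ Γ : (Fin L → Bool) → (Fin L' → Bool) → Bool, (∀ v, HasDeg (fun u => Γ u v) D) → ∀ r : ℕ,
          κ * ((∑ u : Fin L → Bool, distFail D (Γ u) : ℕ) : ℝ) ≤
            ((∑ u ∈ univ.filter (fun u : Fin L → Bool => wt u % 3 = r % 3), distFail D (Γ u) : ℕ) : ℝ)) :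
    Summit.QuantumAdvantage.AdviceFreeQNC0.AdviceFreeQNC0 :=
  Summit.QuantumAdvantage.QuantumAdvantage.Theses.RingFrame.closes (ringToElim_of_ldma hL)
    ringFrame_lowDegAvoidOfRobustHegedus ringFrame_robustHegedusFact ringFrame_elimSqrtOfSparse
    ringFrame_elimHardOfSqrt bridgeRingToSep_proof

end Summit.QuantumAdvantage.QuantumAdvantage.Theorems
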